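import Summits.BirchSwinnertonDyer.BirchSwinnertonDyer.Theorems.ByReductionTypeAtTwoTorsionEulerCharGoodOrd
import Summits.BirchSwinnertonDyer.Rank1Residual.X5.TwoAdicTargetsAlphaAuto
import Summits.BirchSwinnertonDyer.Rank1Residual.X5.TwoAdicTargetsTowerGapEnd
import HarnessLib

set_option linter.dupNamespace false -- `…BirchSwinnertonDyer.BirchSwinnertonDyer…` is the cell's nested layout (D-0017)
set_option autoImplicit false

/-!
# Route `ByReductionTypeAtTwo`, item `OrdKatoHalfAtTwo` (stmt-BirchSwinnertonDyer-19271), GOOD ORDINARY `2`: the upper half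
# `ord₂ #Ш ≤ ord₂ #Ш_an` WITHOUT the PRINT binder `hEC : X5.O1.TwoAdicEulerCharRankZero W 0` and WITHOUT `E(ℚ)[2] = 0` —
# the one-sided G11a′ chain fed by the kernel theorem `TorsionEulerChar.charValue_rankZero_upper_two`

Cell `bsd-2adic` (run/shared/lean/pub/bsd-2adic/), seat `bsd-2adic-tower-1` GEN 32; `--supports stmt-BirchSwinnertonDyer-19271`.
THEOREMS ONLY (no definition, no named fact, no `sorry`); closes no item; nothing booked; no display re-keyed (D-0152); BSD is
not proved by any of this.

WHY. Every good-ordinary upper-half door at `2` of the b2b-bsdres class O1 (`X5.O1.missingUpperBoundAt_two_of_mu_eq_zero(_auto)`,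
`…_of_towerGap`, `…_of_prop514(_auto)`, and the `bsdp_two_of_…_of_lowerBound` end-states) carries the binder
`hEC : X5.O1.TwoAdicEulerCharRankZero W 0` — Greenberg's Thm. 4.1 at `2`, `f_E(0)·#E(ℚ)(2)² = u·2^{ord₂ ∏c}·#Ẽ(𝔽₂)(2)²·#Sel`,
`u ∈ ℤ₂ˣ` — which is KERNEL only on {`E(ℚ)[2] = 0`} (GEN 25 `GreenbergEulerChar.twoAdicEulerCharRankZero_of_noTwoTorsion`) and is
a PRINT input at every curve with a rational `2`-torsion point, i.e. on the whole α-go habitat (Greenberg Prop. 5.14 locus: a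
rational `2`-torsion point ramified-at-`2` XOR odd) that these doors were built for. The doors use only the direction
«`ord₂ h(0) ≥ 0` gives (a)» of `X5.O1.chainUpperAtTwo_of_divisibilityRat`, i.e. `ord₂ f_E(0) + 2·ord₂ #E(ℚ)(2) ≥ ord₂ ∏c +
2·ord₂ #Ẽ(𝔽₂)(2) + ord₂ #Sel`, which part A (`TorsionEulerChar.charValue_rankZero_upper_two`) proves for EVERY good-ordinary-at-`2`
globally minimal `W/ℚ`, rational `2`-torsion allowed (`e ∈ ℤ₂ ∖ {0}` in place of `u`). This file re-runs the chain with `e`: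

* `chainUpperAtTwo_le` — G11a′ (a) with `e ≠ 0`: `ord₂ #Ш + ord₂ ∏c − 2·ord₂ #E(ℚ)_tors + ord₂ ϖ ≤ ord₂ t + ord₂ ϖ′`, NO `hEC`;
* `upperBound_two_le` — Miller's currency: `∃ q, #Ш_an = q ∧ ord₂ #Ш ≤ ord₂ q + k`, NO `hEC`;
* `upperBound_two_le_of_mu_eq_zero` — per datum from `μ = 0` + Kato 17.4 (1)(2)@2 + an integral normaliser, NO `hEC`
  (twin of `X5.O1.upperBound_two_of_mu_eq_zero`).

The per-curve doors (`missingUpperBoundAt_two_goodOrd_of_{mu_eq_zero,towerGap,prop514}(_auto)`, NO `hEC`) are the sequel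
`…TorsionEulerCharGoodOrdDoors`.

HONEST FRAMING: assembly over tree theorems; the remaining displayed inputs are the unchanged PRINT binders {Kato 17.4 (1)(2)@2
`h17`, modularity, GZK, Prop. 5.14 `h514`} and certificates {`hint`/`hper₀`, `μ = 0`/tower gap}; closes no item; no summit
statement is proved; the Birch–Swinnerton-Dyer conjecture is NOT proved by any of this.

References: [GreenbergLNM1716] Thm. 4.1 (p. 102), Prop. 5.14 (p. 121); [MazurTateTeitelbaum1986Invent] §I.12, §I.14;
[Kato2004Asterisque] Thm. 17.4 (1)(2) (p. 273); [GreenbergVatsal2000] p. 4; [Miller2011LMS] Def. 1.1; [Washington1997] §13.2.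
-/

noncomputable section

open scoped Classical MatrixGroups ModularForm

open NumberField IsDedekindDomain CongruenceSubgroup WeierstrassCurve Literature.NumberTheory.EllipticCurves
  Literature.NumberTheory.EllipticCurves.ModularForms
  Literature.NumberTheory.EllipticCurves.Greenberg1999
  Literature.NumberTheory.EllipticCurves.Wuthrich2014
  Literature.NumberTheory.EllipticCurves.Rank1Residual
  Literature.NumberTheory.EllipticCurves.Rank1Residual.Typed
  Summit.BirchSwinnertonDyer.Rank1Residual.X5 Summit.BirchSwinnertonDyer.Rank1Residual.X5.O1

namespace Summit.BirchSwinnertonDyer.BirchSwinnertonDyer.Theorems.TorsionEulerChar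

section PerMember

variable (W : WeierstrassCurve ℚ) [W.IsElliptic] [W.IsGloballyMinimal]

/-! ## §1 G11a′ (a) with `e ≠ 0` -/

/-- **G11a′ (a) at a GOOD ORDINARY `2` from ONE divisibility datum `ι g = ϖ′ · L₂(f, α)`, NO `hEC`, NO hypothesis on
`E(ℚ)[2]`.** For `W/ℚ` globally minimal, good ordinary at `2` (`hord`), `L(E,1) ≠ 0`, `Ш(E/ℚ)` finite, a cyclotomic datum, a
newform `f` of `E`, a dual datum `D`, the period ratio `ϖ` (`ϖ · Ω_E = Ω⁺_f`), a non-zero rational `ϖ′` and the datum «`X`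
torsion and `ϖ′ · L₂(f, α) = ι g` for some `g ∈ char_Λ X`»: `L(E,1)/Ω_E` is a rational `t` with
`ord₂ #Ш + ord₂ ∏ c_ℓ − 2 ord₂ #E(ℚ)_tors + ord₂ ϖ ≤ ord₂ t + ord₂ ϖ′`. The proof is `X5.O1.chainUpperAtTwo_of_divisibilityRat`
Steps 0–8 verbatim with Greenberg's display `hEC` replaced by the kernel theorem `charValue_rankZero_upper_two` (`e ∈ ℤ₂ ∖ {0}`;
`ord₂ e ≥ 0` only sharpens (a)). Clause (b) of G11a′ (the reverse inequality ⇒ `char_Λ X = (g)`) needs the unit and is NOT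
re-derived here. [cite: GreenbergLNM1716, Thm. 4.1 (p. 102)] [cite: MazurTateTeitelbaum1986Invent, §I.14 (14.3)]
[cite: GreenbergVatsal2000, p. 4 (after Thm. (1.2))] -/
theorem chainUpperAtTwo_le (hord : IsOrdinaryAt W 2) (hL : W.entireLFunction 1 ≠ 0) (hfin : Finite W.sha)
    {κ : ZpExtension ℚ 2} {γ : Field.absoluteGaloisGroup ℚ} {N : ℕ} [NeZero N]
    {f : CuspForm (Gamma0 N) 2} (hκ : κ.IsCyclotomic) (hγ : κ.IsTopGenerator γ)
    (hf : IsNewformOf W f) (D : W.SelmerDualData κ γ) (ϖ : ℚ)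
    (hϖ : (ϖ : ℝ) * W.realPeriodRat = plusPeriod f) {ϖ' : ℚ} (hϖ'0 : ϖ' ≠ 0)
    (hdiv : D.IsTorsion ∧ ∃ g ∈ D.charIdeal, iwasawaToPowerSeries 2 g =
        PowerSeries.C (ϖ' : ℚ_[2]) * padicLFunction f (unitRoot W 2 : ℚ_[2])) :
    ∃ t : ℚ, W.entireLFunction 1 / (W.realPeriodRat : ℂ) = (t : ℂ) ∧
      (padicValNat 2 W.shaOrder : ℤ) + padicValNat 2 W.tamagawaProduct -
          2 * padicValNat 2 W.torsionOrder + padicValRat 2 ϖ ≤ padicValRat 2 t + padicValRat 2 ϖ' := by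
  -- adapted from `X5.O1.chainUpperAtTwo_of_divisibilityRat` (cell b2b-bsdres), Steps 0–8, with `hEC` ↦ part A
  have hgo : GoodOrd W 2 := hord
  -- Step 0: the rational number `t = ϖ · [0]⁺_f = L(E,1)/Ω_E`, non-zero; `s = [0]⁺_f`
  have hΩpos : 0 < W.realPeriodRat := W.realPeriodRat_pos_holds
  have hϖ0 : ϖ ≠ 0 := by
    rintro rfl
    have hper : 0 < plusPeriod f := IsNewform0.plusPeriod_pos_holds hf.1 hf.coeffField_eq_bot
    rw [← hϖ, Rat.cast_zero, zero_mul] at hper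
    exact lt_irrefl _ hper
  set s : ℚ := ratPlusSymbol f 0 with hs_def
  set t : ℚ := ϖ * s with ht_def
  have hLval : W.entireLFunction 1 = (((s : ℝ) * plusPeriod f : ℝ) : ℂ) := hf.entireLFunction_one_eq
  have hq : W.entireLFunction 1 / (W.realPeriodRat : ℂ) = ((t : ℚ) : ℂ) := by
    rw [hLval, ← hϖ, div_eq_iff (Complex.ofReal_ne_zero.mpr hΩpos.ne'), ht_def]
    push_cast
    ring
  have hs0 : s ≠ 0 := by
    intro h0
    apply hL
    rw [hLval, h0]
    simp
  have hvt : padicValRat 2 t = padicValRat 2 ϖ + padicValRat 2 s := by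
    rw [ht_def, padicValRat.mul hϖ0 hs0]
  -- Step 1 (the Iwasawa module)
  haveI : Module.Finite (IwasawaAlgebra 2) D.X := D.module_finite_holds hγ
  -- Step 2 (the divisibility datum): a generator `fE` of `char_Λ X` and the cofactor `h`: `g = h · fE`
  obtain ⟨hX, g, hgmem, hιg⟩ := hdiv
  haveI : (Module.charIdeal (IwasawaAlgebra 2) D.X).IsPrincipal := charIdeal_isPrincipal_holds 2 D.X
  obtain ⟨fE, hchar⟩ := Submodule.IsPrincipal.principal (Module.charIdeal (IwasawaAlgebra 2) D.X)
  have hchar' : D.charIdeal = Ideal.span {fE} := hchar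
  have hgmem' : g ∈ Ideal.span {fE} := by rw [← hchar']; exact hgmem
  obtain ⟨h, hgh⟩ := Ideal.mem_span_singleton'.mp hgmem'
  -- Step 3 (interpolation): `g(0) = ϖ′ · (1 - α⁻¹)² [0]⁺_f`
  set a : ℚ_[2] := ((unitRoot W 2 : ℤ_[2]) : ℚ_[2]) with ha
  have hg0 : ((PowerSeries.constantCoeff g : ℤ_[2]) : ℚ_[2]) =
      (ϖ' : ℚ_[2]) * (1 - a⁻¹) ^ 2 * (s : ℚ_[2]) := by
    rw [← constantCoeff_iwasawaToPowerSeries 2 g, hιg, map_mul, PowerSeries.constantCoeff_C,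
      constantCoeff_padicLFunction_unitRoot hord hf]
    ring
  -- `g(0) = h(0) · fE(0)`
  have hg0' : (PowerSeries.constantCoeff g : ℤ_[2]) =
      PowerSeries.constantCoeff h * PowerSeries.constantCoeff fE := by
    rw [← hgh, map_mul]
  -- the bridges `1 - α⁻¹ = u₂ · #Ẽ(𝔽₂)` and `#Ẽ(𝔽₂) = u₃ · #Ẽ(𝔽₂)(2)`; in particular `1 - α⁻¹ ≠ 0`
  obtain ⟨u₂, hu₂⟩ := exists_unit_one_sub_unitRoot_inv 2 W hord
  haveI : NeZero (2 : ℕ) := ⟨two_ne_zero⟩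
  obtain ⟨u₃, hu₃⟩ := exists_unit_natCard_eq_mul_card_primaryComponent
    ((integralModelInt W).map (Int.castRingHom (ZMod 2))).toAffine.Point 2
  set Np : ℚ_[2] := (Nat.card (AddCommGroup.primaryComponent
    ((integralModelInt W).map (Int.castRingHom (ZMod 2))).toAffine.Point 2) : ℚ_[2]) with hNp
  have hNcount : (W.reductionPointCount 2 : ℚ_[2]) = ((u₃ : ℤ_[2]) : ℚ_[2]) * Np := by
    rw [WeierstrassCurve.reductionPointCount, hNp]
    exact hu₃
  have hNp0 : Np ≠ 0 := by
    rw [hNp]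
    exact_mod_cast Nat.card_pos.ne'
  have h1 : (1 - a⁻¹) = ((u₂ : ℤ_[2]) : ℚ_[2]) * ((u₃ : ℤ_[2]) : ℚ_[2]) * Np := by
    rw [hu₂, hNcount, mul_assoc]
  have hsQ0 : (s : ℚ_[2]) ≠ 0 := by exact_mod_cast hs0
  have hϖ'Q0 : (ϖ' : ℚ_[2]) ≠ 0 := by exact_mod_cast hϖ'0
  have hU0 : ((u₂ : ℤ_[2]) : ℚ_[2]) * ((u₃ : ℤ_[2]) : ℚ_[2]) ≠ 0 :=
    mul_ne_zero (coe_units_ne_zero 2 u₂) (coe_units_ne_zero 2 u₃)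
  have h20 : (2 : ℚ_[2]) ≠ 0 := two_ne_zero
  -- Step 4 (finiteness): `g(0) ≠ 0`, hence `fE(0) ≠ 0`, `h(0) ≠ 0`, `Sel_{2^∞}(E/ℚ)` finite
  have hg00 : PowerSeries.constantCoeff g ≠ 0 := by
    intro h0
    rw [h0, PadicInt.coe_zero, h1] at hg0
    exact (mul_ne_zero (mul_ne_zero hϖ'Q0
      (pow_ne_zero 2 (mul_ne_zero hU0 hNp0))) hsQ0) hg0.symm
  have hfE00 : PowerSeries.constantCoeff fE ≠ 0 := by
    intro h0
    apply hg00
    rw [hg0', h0, mul_zero]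
  have hh00 : PowerSeries.constantCoeff h ≠ 0 := by
    intro h0
    apply hg00
    rw [hg0', h0, zero_mul]
  have hSelfin : Finite (W.selmerGroupPInfty 2) :=
    D.finite_selmerGroupPInfty_of_constantCoeff_ne_zero W hγ hX fE hchar' hfE00
  obtain ⟨hEfin, hShapfin⟩ := (W.finite_selmerGroupPInfty_iff 2).mp hSelfin
  haveI := hEfin
  haveI := hShapfin
  haveI := hSelfin
  haveI : Finite W.sha := hfin
  -- Step 5 — THE KERNEL UPPER-HALF DISPLAY (part A) instead of Greenberg's `hEC`: `e ∈ ℤ₂ ∖ {0}`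
  obtain ⟨e, he, hu₁⟩ := charValue_rankZero_upper_two W hgo κ hκ hγ D fE hchar'
  -- Step 6 (the remaining bridges)
  obtain ⟨u₄, hu₄⟩ := exists_unit_torsionOrder_eq W 2
  obtain ⟨u₅, hu₅⟩ := exists_unit_natCard_eq_mul_card_primaryComponent W.sha 2
  have hSel : Nat.card (W.selmerGroupPInfty 2) = Nat.card (AddCommGroup.primaryComponent W.sha 2) :=
    W.natCard_selmerGroupPInfty_eq_natCard_primaryComponent_sha 2
  -- abbreviations
  set v := padicValNat 2 W.tamagawaProduct with hv
  set Tp : ℚ_[2] := (Nat.card (AddCommGroup.primaryComponent W.toAffine.Point 2) : ℚ_[2]) with hTp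
  set Shp : ℚ_[2] := (Nat.card (AddCommGroup.primaryComponent W.sha 2) : ℚ_[2]) with hShp
  set h0 : ℚ_[2] := ((PowerSeries.constantCoeff h : ℤ_[2]) : ℚ_[2]) with hh0
  set e0 : ℚ_[2] := ((e : ℤ_[2]) : ℚ_[2]) with he0
  have hh0ne : h0 ≠ 0 := by
    rw [hh0]
    intro h0'
    exact hh00 (by exact_mod_cast (PadicInt.coe_eq_zero.mp h0'))
  have hh0val : 0 ≤ h0.valuation := by
    rw [hh0]
    exact PadicInt.valuation_coe_nonneg
  have he0ne : e0 ≠ 0 := by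
    rw [he0]
    intro h0'
    exact he (PadicInt.coe_eq_zero.mp h0')
  have he0val : 0 ≤ e0.valuation := by
    rw [he0]
    exact PadicInt.valuation_coe_nonneg
  -- `#E(ℚ)_tors = u₄ · Tp` (up to the `DecidableEq ℚ` instance inside the group law)
  have hu₄' : (W.torsionOrder : ℚ_[2]) = ((u₄ : ℤ_[2]) : ℚ_[2]) * Tp := by
    rw [hu₄, hTp]
    congr 1
    exact_mod_cast natCard_primaryComponent_point_congr W 2 _ _
  -- `#Ш = u₅ · Shp`, `#Sel = Shp`
  have hSha : (W.shaOrder : ℚ_[2]) = ((u₅ : ℤ_[2]) : ℚ_[2]) * Shp := by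
    rw [WeierstrassCurve.shaOrder, hShp]
    exact hu₅
  have hSel' : (Nat.card (W.selmerGroupPInfty 2) : ℚ_[2]) = Shp := by rw [hShp, hSel]
  -- `g(0) = h0 · fE(0)` in `ℚ_2`
  have hg0Q : ((PowerSeries.constantCoeff g : ℤ_[2]) : ℚ_[2]) =
      h0 * ((PowerSeries.constantCoeff fE : ℤ_[2]) : ℚ_[2]) := by
    rw [hg0', hh0]; push_cast; ring
  -- the kernel display with the abbreviations
  have hu₁' : ((PowerSeries.constantCoeff fE : ℤ_[2]) : ℚ_[2]) * Tp ^ 2 =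
      e0 * (2 : ℚ_[2]) ^ v * Np ^ 2 * (Nat.card (W.selmerGroupPInfty 2) : ℚ_[2]) := by
    have h := hu₁
    rw [hTp, he0, hv, hNp]
    convert h using 4
  -- Step 7: the identity `ϖ′ · s · Tp² · (u₂ u₃)² = h0 · e0 · 2^v · Shp` in `ℚ_2`
  have key : (ϖ' : ℚ_[2]) * (s : ℚ_[2]) * Tp ^ 2 *
      (((u₂ : ℤ_[2]) : ℚ_[2]) * ((u₃ : ℤ_[2]) : ℚ_[2])) ^ 2 =
      h0 * (e0 * (2 : ℚ_[2]) ^ v * Shp) := by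
    apply mul_right_cancel₀ (pow_ne_zero 2 hNp0)
    calc (ϖ' : ℚ_[2]) * (s : ℚ_[2]) * Tp ^ 2 *
          (((u₂ : ℤ_[2]) : ℚ_[2]) * ((u₃ : ℤ_[2]) : ℚ_[2])) ^ 2 * Np ^ 2
        = ((ϖ' : ℚ_[2]) * (1 - a⁻¹) ^ 2 * (s : ℚ_[2])) * Tp ^ 2 := by rw [h1]; ring
      _ = h0 * (((PowerSeries.constantCoeff fE : ℤ_[2]) : ℚ_[2]) * Tp ^ 2) := by
          rw [← hg0, hg0Q]; ring
      _ = h0 * (e0 * (2 : ℚ_[2]) ^ v * Np ^ 2 *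
            (Nat.card (W.selmerGroupPInfty 2) : ℚ_[2])) := by rw [hu₁']
      _ = h0 * (e0 * (2 : ℚ_[2]) ^ v * Shp) * Np ^ 2 := by rw [hSel']; ring
  -- Step 8: valuations
  have hTp0 : Tp ≠ 0 := by rw [hTp]; exact_mod_cast Nat.card_pos.ne'
  have hShp0 : Shp ≠ 0 := by rw [hShp]; exact_mod_cast Nat.card_pos.ne'
  have hv2 : (2 : ℚ_[2]).valuation = 1 := by
    have h2 : ((2 : ℕ) : ℚ_[2]).valuation = 1 := Padic.valuation_p
    rwa [Nat.cast_ofNat] at h2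
  have hvalL : ((ϖ' : ℚ_[2]) * (s : ℚ_[2]) * Tp ^ 2 *
      (((u₂ : ℤ_[2]) : ℚ_[2]) * ((u₃ : ℤ_[2]) : ℚ_[2])) ^ 2).valuation =
      padicValRat 2 ϖ' + padicValRat 2 s + 2 * Tp.valuation := by
    rw [Padic.valuation_mul (mul_ne_zero (mul_ne_zero hϖ'Q0 hsQ0) (pow_ne_zero 2 hTp0))
        (pow_ne_zero 2 hU0),
      Padic.valuation_mul (mul_ne_zero hϖ'Q0 hsQ0) (pow_ne_zero 2 hTp0),
      Padic.valuation_mul hϖ'Q0 hsQ0, Padic.valuation_pow Tp, Padic.valuation_pow,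
      Padic.valuation_mul (coe_units_ne_zero 2 u₂) (coe_units_ne_zero 2 u₃),
      valuation_coe_units_eq_zero, valuation_coe_units_eq_zero, Padic.valuation_ratCast,
      Padic.valuation_ratCast]
    push_cast
    ring
  have hvalR : (h0 * (e0 * (2 : ℚ_[2]) ^ v * Shp)).valuation =
      h0.valuation + (e0.valuation + v + Shp.valuation) := by
    rw [Padic.valuation_mul hh0ne (mul_ne_zero (mul_ne_zero he0ne (pow_ne_zero v h20)) hShp0),
      Padic.valuation_mul (mul_ne_zero he0ne (pow_ne_zero v h20)) hShp0,
      Padic.valuation_mul he0ne (pow_ne_zero v h20), Padic.valuation_pow, hv2]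
    ring
  have hval := congrArg Padic.valuation key
  rw [hvalL, hvalR] at hval
  -- `v(Tp) = v(#E(ℚ)_tors)`, `v(Shp) = v(#Ш)`
  have hvT : Tp.valuation = (padicValNat 2 W.torsionOrder : ℤ) := by
    have h := congrArg Padic.valuation hu₄'
    rw [Padic.valuation_natCast, Padic.valuation_mul (coe_units_ne_zero 2 u₄) hTp0,
      valuation_coe_units_eq_zero, zero_add] at h
    exact h.symm
  have hvS : Shp.valuation = (padicValNat 2 W.shaOrder : ℤ) := by
    have h := congrArg Padic.valuation hSha
    rw [Padic.valuation_natCast, Padic.valuation_mul (coe_units_ne_zero 2 u₅) hShp0,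
      valuation_coe_units_eq_zero, zero_add] at h
    exact h.symm
  rw [hvT, hvS] at hval
  exact ⟨t, hq, by linarith⟩

/-! ## §2 Miller's currency, and the `μ = 0` datum -/

/-- **G11a′ (a) in Miller's currency at a GOOD ORDINARY `2`, NO `hEC`** (`ι g = ϖ′ · L₂(f, α)`, `g ∈ char_Λ X`, `X` torsion,
`ord₂ ϖ′ ≤ ord₂ ϖ + k`): `L(E,1) ≠ 0`, GZK (`#Ш_an = t · #E(ℚ)² / ∏c_ℓ`) ⇒ `∃ q, #Ш_an = q ∧ ord₂ #Ш ≤ ord₂ q + k`; at `k = 0`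
this is `MissingUpperBoundAt W 2`. Twin of `X5.O1.upperBound_two_of_divisibilityRat` on §1.
[cite: Miller2011LMS, Def. 1.1 and §1] [cite: GreenbergLNM1716, Thm. 4.1 (p. 102)] -/
theorem upperBound_two_le (hGZK : rank_eq_analyticRank_of_analyticRank_le_one)
    (hord : IsOrdinaryAt W 2) (hL : W.entireLFunction 1 ≠ 0)
    {κ : ZpExtension ℚ 2} {γ : Field.absoluteGaloisGroup ℚ} {N : ℕ} [NeZero N]
    {f : CuspForm (Gamma0 N) 2} (hκ : κ.IsCyclotomic) (hγ : κ.IsTopGenerator γ)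
    (hf : IsNewformOf W f) (D : W.SelmerDualData κ γ) (ϖ : ℚ)
    (hϖ : (ϖ : ℝ) * W.realPeriodRat = plusPeriod f) {ϖ' : ℚ} (hϖ'0 : ϖ' ≠ 0) (k : ℕ)
    (hk : padicValRat 2 ϖ' ≤ padicValRat 2 ϖ + k)
    (hdiv : D.IsTorsion ∧ ∃ g ∈ D.charIdeal, iwasawaToPowerSeries 2 g =
        PowerSeries.C (ϖ' : ℚ_[2]) * padicLFunction f (unitRoot W 2 : ℚ_[2])) :
    ∃ q : ℚ, shaAn W = (q : ℂ) ∧ (padicValNat 2 W.shaOrder : ℤ) ≤ padicValRat 2 q + k := by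
  -- adapted from `X5.O1.upperBound_two_of_divisibilityRat` (cell b2b-bsdres)
  have hr : W.analyticRank = 0 := analyticRank_eq_zero_of_entireLFunction_one_ne_zero W hL
  obtain ⟨-, hfin⟩ := hGZK W (by rw [hr]; exact zero_le_one)
  obtain ⟨t, ht, hle⟩ := chainUpperAtTwo_le W hord hL hfin hκ hγ hf D ϖ hϖ hϖ'0 hdiv
  obtain ⟨-, hE, -, hshaAn⟩ := shaAn_eq_of_L_one_div_eq hGZK W hL ht
  haveI := hE
  have hΩ : (W.realPeriodRat : ℂ) ≠ 0 := by exact_mod_cast W.realPeriodRat_pos_holds.ne'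
  have ht0 : t ≠ 0 := by
    rintro rfl
    apply hL
    rw [Rat.cast_zero, div_eq_zero_iff] at ht
    exact ht.resolve_right hΩ
  have hcard : (Nat.card W.toAffine.Point : ℚ) ≠ 0 := by
    exact_mod_cast (Nat.card_pos (α := W.toAffine.Point)).ne'
  have htam : (W.tamagawaProduct : ℚ) ≠ 0 := by
    exact_mod_cast (W.tamagawaProduct_pos_holds : 0 < W.tamagawaProduct).ne'
  have hcardT : (Nat.card W.toAffine.Point : ℚ) = (W.torsionOrder : ℚ) := by
    exact_mod_cast (W.torsionOrder_eq_natCard_of_finite).symm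
  refine ⟨t * (Nat.card W.toAffine.Point : ℚ) ^ 2 / (W.tamagawaProduct : ℚ), hshaAn, ?_⟩
  rw [padicValRat.div (mul_ne_zero ht0 (pow_ne_zero 2 hcard)) htam,
    padicValRat.mul ht0 (pow_ne_zero 2 hcard), padicValRat.pow, hcardT]
  simp only [padicValRat.of_nat, Nat.cast_ofNat]
  linarith

/-- **Upper half at `2` from `μ = 0`, per datum, NO `hEC`.** Good ordinary `2` (`hord`), `L(E,1) ≠ 0`, GZK; Kato 17.4 (1)(2) AT
`2` for the newform `f` (`h17`, PRINT, parity-free); a dual datum `D` with `D.mu = 0`; the period ratio `ϖ` and an integral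
normalisation `ι L₀ = ϖ′ · L₂(f, α)`, `ϖ′ ≠ 0`, `ord₂ ϖ′ ≤ ord₂ ϖ + k` ⟹ `∃ q, #Ш_an = q ∧ ord₂ #Ш ≤ ord₂ q + k`. Twin of
`X5.O1.upperBound_two_of_mu_eq_zero`: the refuter's `MuZeroUpgrade.charIdeal_dvd_of_kato_allPrimes_of_mu_eq_zero` + §2.
[cite: Kato2004Asterisque, Thm. 17.4 (1)(2) (p. 273)] [cite: GreenbergVatsal2000, p. 4 (after Thm. (1.2))] -/
theorem upperBound_two_le_of_mu_eq_zero (hGZK : rank_eq_analyticRank_of_analyticRank_le_one)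
    (hord : IsOrdinaryAt W 2) (hL : W.entireLFunction 1 ≠ 0)
    {κ : ZpExtension ℚ 2} {γ : Field.absoluteGaloisGroup ℚ} {N : ℕ} [NeZero N]
    {f : CuspForm (Gamma0 N) 2} (h17 : kato_divisibility_allPrimes W 2 (f := f))
    (hκ : κ.IsCyclotomic) (hγ : κ.IsTopGenerator γ) (hγ' : IsCyclotomicVariable 2 γ)
    (hf : IsNewformOf W f) (D : W.SelmerDualData κ γ) (hμ : D.mu = 0) (ϖ : ℚ)
    (hϖ : (ϖ : ℝ) * W.realPeriodRat = plusPeriod f) {ϖ' : ℚ} (hϖ'0 : ϖ' ≠ 0) (k : ℕ)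
    (hk : padicValRat 2 ϖ' ≤ padicValRat 2 ϖ + k) {L₀ : IwasawaAlgebra 2}
    (hL₀ : iwasawaToPowerSeries 2 L₀ =
      PowerSeries.C (ϖ' : ℚ_[2]) * padicLFunction f (unitRoot W 2 : ℚ_[2])) :
    ∃ q : ℚ, shaAn W = (q : ℂ) ∧ (padicValNat 2 W.shaOrder : ℤ) ≤ padicValRat 2 q + k := by
  obtain ⟨hX, hmem⟩ :=
    MuZeroUpgrade.charIdeal_dvd_of_kato_allPrimes_of_mu_eq_zero W 2 h17 hκ hγ hγ' hord hf D hμ hL₀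
  exact upperBound_two_le W hGZK hord hL hκ hγ hf D ϖ hϖ hϖ'0 k hk ⟨hX, L₀, hmem, hL₀⟩

end PerMember

end Summit.BirchSwinnertonDyer.BirchSwinnertonDyer.Theorems.TorsionEulerChar

end
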